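import Summits.MatrixMultiplication.MatrixMultiplication.Theses.MarginalColumns
import Literature.Computability.AlgebraicComplexity.BorderRankMatMulTwoSeven
import Literature.Computability.AlgebraicComplexity.BorderRankMatMulSmall

/-!
# Negative lemmas for the crux `SecondColumnDominates` (stmt-MatrixMultiplication-16310):
# load-bearing binders, trivial slices, tightness of the first cell

Refuter vetting of route `MarginalColumns`, crux D = `SecondColumnDominates`:
`∀ n w ≥ 1, T n (w+1) + T n 1 ≤ T n w + T n 2` with `T n w := algBorderRank (matMulTensor ℂ n n w)`
(`= R̲⟨n,n,w⟩`, an `n × n` matrix times an `n × w` matrix, Bläser's border rank over `ℂ[ε]`).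
No theorem below asserts a Theses statement positively and no definition is introduced; everything
is proved from tree theorems (flattening, the standard algorithm, Strassen's `R̲⟨2,2,2⟩ ≤ 7`), the
last lemma from two vendored named facts taken as hypotheses.

* `algBorderRank_matMulTensor_le_card`, `…_zero_left`, `…_zero_right`, `mul_self_le_algBorderRank_matMulTensor`,
  `algBorderRank_matMulTensor_sq_one`, `algBorderRank_matMulTensor_one_one` — the degenerate values:
  `R̲⟨k,m,w⟩ ≤ kmw`, `R̲⟨0,0,w⟩ = R̲⟨n,n,0⟩ = 0`, `R̲⟨n,n,1⟩ = n²`, `R̲⟨1,1,w⟩ = w`.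
* `cell_w_one` — the `w = 1` slice of D is the tautology `a + b ≤ b + a`: D's content starts at
  `w = 2` (cell `(2,2)`: `10 + 4 ≤ 7 + 7`; first open cell `(3,2)` = `R̲⟨3,3,3⟩ ≤ 19`).
* `cell_n_zero`, `cell_n_one`, `secondColumnDominates_iff_without_hn` — the slices `n = 0` (all four
  border ranks vanish) and `n = 1` (`(w+1) + 1 ≤ w + 2`) hold outright, so the binder `1 ≤ n` is
  REMOVABLE: D is equivalent to D without it.
* `secondColumnDominates_false_without_hw` — the binder `1 ≤ w` is LOAD-BEARING: at `(n,w) = (2,0)`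
  the cell reads `R̲⟨2,2,1⟩ + R̲⟨2,2,1⟩ ≤ R̲⟨2,2,0⟩ + R̲⟨2,2,2⟩`, i.e. `4 + 4 ≤ 0 + (≤ 7)` — false.
* `cell_two_two_eq_of_facts` — TIGHTNESS of the first cell: from the printed values
  `R̲⟨2,2,3⟩ = 10` (Conner–Harper–Landsberg 2023 Thm 1.3) and `R̲⟨2,2,2⟩ = 7` (Landsberg 2006) the
  cell `(2,2)` is an EQUALITY `10 + 4 = 7 + 7`; no uniform slack can be added to D.
-/

set_option linter.dupNamespace false

noncomputable section

namespace Summit.MatrixMultiplication.MatrixMultiplication.Theorems.SecondColumnDominates.Negative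

open Literature.Computability.AlgebraicComplexity
open Summit.MatrixMultiplication.MatrixMultiplication.Theses.MarginalColumns

/-! ## Degenerate values of the column tower -/

/-- `R̲⟨k,m,w⟩ ≤ k·m·w` (standard algorithm and `R̲ ≤ R`). -/
theorem algBorderRank_matMulTensor_le_card (k m w : ℕ) :
    algBorderRank (matMulTensor ℂ k m w) ≤ k * m * w :=
  (algBorderRank_le_tensorRank _).trans (tensorRank_matMulTensor_le ℂ k m w)

/-- `R̲⟨0,0,w⟩ = 0`. -/
theorem algBorderRank_matMulTensor_zero_left (w : ℕ) :
    algBorderRank (matMulTensor ℂ 0 0 w) = 0 :=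
  Nat.le_zero.1 (by simpa using algBorderRank_matMulTensor_le_card 0 0 w)

/-- `R̲⟨n,n,0⟩ = 0` (no column: the zero tensor). -/
theorem algBorderRank_matMulTensor_zero_right (n : ℕ) :
    algBorderRank (matMulTensor ℂ n n 0) = 0 :=
  Nat.le_zero.1 (by simpa using algBorderRank_matMulTensor_le_card n n 0)

/-- Flattening: `n·n ≤ R̲⟨n,n,w⟩` for `w ≥ 1` (as in step 0 of the route's `closes`). -/
theorem mul_self_le_algBorderRank_matMulTensor (n w : ℕ) (hw : 1 ≤ w) :
    n * n ≤ algBorderRank (matMulTensor ℂ n n w) := by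
  haveI : NeZero w := ⟨Nat.one_le_iff_ne_zero.1 hw⟩
  have h := card_le_algBorderRank_of_linearIndependent _
    (linearIndependent_rotate_matMulTensor ℂ n n w)
  rw [algBorderRank_rotate] at h
  simpa [Fintype.card_prod, Fintype.card_fin] using h

/-- `R̲⟨n,n,1⟩ = n·n` (first column: flattening below, standard algorithm above). -/
theorem algBorderRank_matMulTensor_sq_one (n : ℕ) :
    algBorderRank (matMulTensor ℂ n n 1) = n * n :=
  le_antisymm (by simpa using algBorderRank_matMulTensor_le_card n n 1)
    (mul_self_le_algBorderRank_matMulTensor n 1 le_rfl)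

/-- `R̲⟨1,1,w⟩ = w` (a scalar times a row of length `w`): the `n = 1` tower is exactly linear. -/
theorem algBorderRank_matMulTensor_one_one (w : ℕ) :
    algBorderRank (matMulTensor ℂ 1 1 w) = w := by
  refine le_antisymm (by simpa using algBorderRank_matMulTensor_le_card 1 1 w) ?_
  have h := card_le_algBorderRank_of_linearIndependent _
    (linearIndependent_rotate_rotate_matMulTensor ℂ 1 1 w)
  rw [algBorderRank_rotate, algBorderRank_rotate] at h
  simpa [Fintype.card_prod, Fintype.card_fin] using h

/-! ## Trivial slices: where the content of D starts -/

/-- The `w = 1` slice of D is the tautology `T n 2 + T n 1 ≤ T n 1 + T n 2`. -/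
theorem cell_w_one (n : ℕ) :
    algBorderRank (matMulTensor ℂ n n (1 + 1)) + algBorderRank (matMulTensor ℂ n n 1) ≤
      algBorderRank (matMulTensor ℂ n n 1) + algBorderRank (matMulTensor ℂ n n 2) := by
  rw [add_comm]

/-- The `n = 0` slice of D holds: all four border ranks are `0`. -/
theorem cell_n_zero (w : ℕ) :
    algBorderRank (matMulTensor ℂ 0 0 (w + 1)) + algBorderRank (matMulTensor ℂ 0 0 1) ≤
      algBorderRank (matMulTensor ℂ 0 0 w) + algBorderRank (matMulTensor ℂ 0 0 2) := by
  simp [algBorderRank_matMulTensor_zero_left]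

/-- The `n = 1` slice of D holds with equality: `(w + 1) + 1 ≤ w + 2`. -/
theorem cell_n_one (w : ℕ) :
    algBorderRank (matMulTensor ℂ 1 1 (w + 1)) + algBorderRank (matMulTensor ℂ 1 1 1) ≤
      algBorderRank (matMulTensor ℂ 1 1 w) + algBorderRank (matMulTensor ℂ 1 1 2) := by
  have h1 := algBorderRank_matMulTensor_one_one (w + 1)
  have h2 := algBorderRank_matMulTensor_one_one 1
  have h3 := algBorderRank_matMulTensor_one_one w
  have h4 := algBorderRank_matMulTensor_one_one 2
  omega

/-- The binder `1 ≤ n` of D is removable: D is equivalent to the same inequality for all `n`. -/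
theorem secondColumnDominates_iff_without_hn :
    SecondColumnDominates ↔
    ∀ n w : ℕ, 1 ≤ w →
      algBorderRank (matMulTensor ℂ n n (w + 1)) + algBorderRank (matMulTensor ℂ n n 1) ≤
        algBorderRank (matMulTensor ℂ n n w) + algBorderRank (matMulTensor ℂ n n 2) := by
  refine ⟨fun h n w hw => ?_, fun h n w _ hw => h n w hw⟩
  rcases Nat.eq_zero_or_pos n with rfl | hn
  · exact cell_n_zero w
  · exact h n w hn hw

/-! ## The binder `1 ≤ w` is load-bearing -/

/-- D without `1 ≤ w` is FALSE: at `(n, w) = (2, 0)` it says `R̲⟨2,2,1⟩ + R̲⟨2,2,1⟩ ≤ R̲⟨2,2,0⟩ + R̲⟨2,2,2⟩`,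
i.e. `4 + 4 ≤ 0 + R̲⟨2,2,2⟩ ≤ 7` (Strassen). Any proof of D must use `1 ≤ w`. -/
theorem secondColumnDominates_false_without_hw :
    ¬ ∀ n w : ℕ, 1 ≤ n →
      algBorderRank (matMulTensor ℂ n n (w + 1)) + algBorderRank (matMulTensor ℂ n n 1) ≤
        algBorderRank (matMulTensor ℂ n n w) + algBorderRank (matMulTensor ℂ n n 2) := by
  intro h
  have h20 := h 2 0 (by norm_num)
  have h7 := algBorderRank_matMulTensor_two_le_seven ℂ
  have h4 := mul_self_le_algBorderRank_matMulTensor 2 1 le_rfl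
  have h4' := mul_self_le_algBorderRank_matMulTensor 2 (0 + 1) le_rfl
  rw [algBorderRank_matMulTensor_zero_right] at h20
  omega

/-! ## Tightness of the first cell -/

/-- The first non-trivial cell `(n, w) = (2, 2)` of D is an EQUALITY in print:
`R̲⟨2,2,3⟩ + R̲⟨2,2,1⟩ = 10 + 4 = 7 + 7 = R̲⟨2,2,2⟩ + R̲⟨2,2,2⟩`, from the vendored named facts
`R̲⟨2,2,3⟩ = 10` (Conner–Harper–Landsberg 2023, Thm 1.3) and `R̲⟨2,2,2⟩ = 7` (Landsberg 2006), taken as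
hypotheses. So D admits no uniform slack. -/
theorem cell_two_two_eq_of_facts (h10 : ConnerHarperLandsberg2023_thm_1_3)
    (h7 : Landsberg2005_borderRank_matMulTensor_two) :
    algBorderRank (matMulTensor ℂ 2 2 (2 + 1)) + algBorderRank (matMulTensor ℂ 2 2 1) =
      algBorderRank (matMulTensor ℂ 2 2 2) + algBorderRank (matMulTensor ℂ 2 2 2) := by
  have h4 := algBorderRank_matMulTensor_sq_one 2
  unfold ConnerHarperLandsberg2023_thm_1_3 at h10
  unfold Landsberg2005_borderRank_matMulTensor_two at h7
  simp only [Nat.reduceAdd] 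
  omega

end Summit.MatrixMultiplication.MatrixMultiplication.Theorems.SecondColumnDominates.Negative

end
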